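import Summits.Ventures.PercRepro.S1CoreCapSpecSpread
import Summits.Ventures.PercRepro.S1CoreCapSpecFourMain

/-!
# PercRepro — TOWARDS THE INSTANCE `ν = 4` OF THE SPREAD SPEC (`FourCapSpecSpread capPaper 4 6`): TWO OF ITS THREE LEGS (p1, gen 31)

`proofs/P1-S2-CORANK6.md` §4d. The search `fourcap_spread3.py` reads `Q*_spread(4) = 6` (against `Q*(4) = 8`). The proof pattern of
`S1CoreCapSpecFourMain.fourCapSpec_four` (P1-S4-CAPBRIDGE.md §13) has three legs; under the spread clause
«`lineRank l ≤ 4 → wsum (unionL l) ≤ lineRank l + 3`» two of them sharpen at once and are proved here: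
* **two lines** (`cap_add_cap_le_five_spread`): the two-line list has `lineRank ∈ {3, 4}`, so `wsum (L' ∪ L) ≤ 7 − |L' ∩ L|` — the cells
  `(4,0) + (4,0)` (weight 8, the maximiser `8` of §13) and every other pair above weight `7` are gone; the table gives `≤ 5`;
* **a line of weight `4`** leaves room for at most TWO others (`card_le_three_of_weight_four_spread`; §13 (iii) allowed three): with three
  others `a, b, c`, `c` lies in `b ∪ a ∪ L₁` (`subset_of_weight_four`) with at most one point on each, so `c` has `≥ 2` points on `a ∪ L₁`
  and `≥ 1` off it; the sub-list `[c, a, L₁]` then has `lineRank = lineRank [a, L₁] = 4 − |a ∩ L₁| ≤ 4` (`c` adds no rank) and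
  `wsum ≥ 4 + (3 − |a ∩ L₁|) + 1 = 8 − |a ∩ L₁|`, against the clause's `≤ 7 − |a ∩ L₁|`.
The third leg — every line a simple 3-point line ⟹ at most `6` lines (the search: at most `5`, the `K₄` triangle system plus a disjoint line) —
is NOT here (the `|P| ≥ 9` case analysis of §4d); with it, `fourCapSpecSpread_four : FourCapSpecSpread capPaper 4 6` follows by the assembly
of `fourCapSpec_four` with `8 ↦ 6` (a weight-4 line: `4 + 2·1 = 6` or `3·2 = 6`). Axioms: standard.
-/

namespace PercRepro

namespace S1

namespace FourCap

variable {β : Type} [DecidableEq β]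

section SpreadFour

variable {w : β → ℕ} {ls : Finset (Finset β)}
  (h1 : ∀ L ∈ ls, ∀ v ∈ L, w v = 1 ∨ w v = 2)
  (h2 : ∀ L ∈ ls, 3 ≤ L.card ∧ wsum w L ≤ 5)
  (h3 : ∀ L ∈ ls, ∀ L' ∈ ls, L ≠ L' → (L ∩ L').card ≤ 1)
  (h4 : ∀ l : List (Finset β), l.Nodup → (∀ L ∈ l, L ∈ ls) → wsum w (unionL l) ≤ 4 + lineRank l)
  (h7 : ∀ l : List (Finset β), l.Nodup → (∀ L ∈ l, L ∈ ls) → lineRank l ≤ 4 → wsum w (unionL l) ≤ lineRank l + 3)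

include h7 in
/-- The two-line spread clause, unpacked: for distinct lines `L, L'`, if `min |L| 2 + min |L' ∖ L| (2 − min |L' ∩ L| 2) ≤ 4` then
`wsum (L' ∪ L) ≤ that + 3`. -/
theorem two_line_spread {L L' : Finset β} (hL : L ∈ ls) (hL' : L' ∈ ls) (hne : L' ≠ L)
    (hr : min L.card 2 + min (L' \ L).card (2 - min (L' ∩ L).card 2) ≤ 4) :
    wsum w (L' ∪ L) ≤ min L.card 2 + min (L' \ L).card (2 - min (L' ∩ L).card 2) + 3 := by
  have h := h7 [L', L] (by simp [hne]) (by simp [hL, hL'])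
  simp only [unionL, lineRank, Finset.union_empty, Finset.sdiff_empty, Finset.inter_empty, Finset.card_empty,
    Nat.zero_add] at h
  rw [show (2 - min 0 2 : ℕ) = 2 by decide] at h
  exact h hr

include h1 h2 h3 h7 in
/-- **Two lines under the spread clause have caps summing to `≤ 5`** (the cell `(3,0) + (4,0)`, or one `5`-line): the two-line list has
`lineRank = 4 − |L' ∩ L| ≤ 4`, so `wsum (L' ∪ L) ≤ 7 − |L' ∩ L|`. -/
theorem cap_add_cap_le_five_spread {L L' : Finset β} (hL : L ∈ ls) (hL' : L' ∈ ls) (hne : L' ≠ L) :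
    capPaper L.card (fat w L) + capPaper L'.card (fat w L') ≤ 5 := by
  have hint : (L' ∩ L).card ≤ 1 := h3 L' hL' L hL hne
  have kL := h2 L hL
  have kL' := h2 L' hL'
  have wL := wsum_eq_card_add_fat w L (h1 L hL)
  have wL' := wsum_eq_card_add_fat w L' (h1 L' hL')
  have hsd : (L' \ L).card + (L' ∩ L).card = L'.card := by
    rw [Finset.card_sdiff, Finset.inter_comm]
    exact Nat.sub_add_cancel (Finset.card_le_card Finset.inter_subset_left)
  have hr : min L.card 2 + min (L' \ L).card (2 - min (L' ∩ L).card 2) ≤ 4 := by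
    have : min L.card 2 ≤ 2 := min_le_right _ _
    have : min (L' \ L).card (2 - min (L' ∩ L).card 2) ≤ 2 - min (L' ∩ L).card 2 := min_le_right _ _
    omega
  have hc := two_line_spread h7 hL hL' hne hr
  have hwu : wsum w (L' ∪ L) = wsum w L' + wsum w (L \ L') := (wsum_union_ge w L' L).symm
  have hsplit : wsum w (L \ L') + wsum w (L ∩ L') = wsum w L := by
    rw [← wsum_union_of_disjoint w (Finset.disjoint_sdiff_inter L L'), Finset.sdiff_union_inter]
  have hcases : (L.card = 3 ∧ fat w L = 0) ∨ (L.card = 4 ∧ fat w L = 0) ∨ (L.card = 5 ∧ fat w L = 0) ∨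
      (L.card = 3 ∧ fat w L = 1) ∨ (L.card = 4 ∧ fat w L = 1) ∨ (L.card = 3 ∧ fat w L = 2) := by omega
  have hcases' : (L'.card = 3 ∧ fat w L' = 0) ∨ (L'.card = 4 ∧ fat w L' = 0) ∨ (L'.card = 5 ∧ fat w L' = 0) ∨
      (L'.card = 3 ∧ fat w L' = 1) ∨ (L'.card = 4 ∧ fat w L' = 1) ∨ (L'.card = 3 ∧ fat w L' = 2) := by omega
  have hcomm : (L ∩ L').card = (L' ∩ L).card := by rw [Finset.inter_comm]
  rcases (by omega : (L ∩ L').card = 0 ∨ (L ∩ L').card = 1) with h0 | hone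
  · have hempty : wsum w (L ∩ L') = 0 := by
      rw [Finset.card_eq_zero.1 h0]; simp [wsum]
    rcases hcases with ⟨hk, hf⟩ | ⟨hk, hf⟩ | ⟨hk, hf⟩ | ⟨hk, hf⟩ | ⟨hk, hf⟩ | ⟨hk, hf⟩ <;>
      rcases hcases' with ⟨hk', hf'⟩ | ⟨hk', hf'⟩ | ⟨hk', hf'⟩ | ⟨hk', hf'⟩ | ⟨hk', hf'⟩ | ⟨hk', hf'⟩ <;>
      first | omega | (rw [hk, hf, hk', hf']; decide)
  · obtain ⟨p, hp⟩ := Finset.card_eq_one.1 hone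
    have hpL : p ∈ L := (Finset.mem_inter.1 (hp ▸ Finset.mem_singleton_self p)).1
    have hpL' : p ∈ L' := (Finset.mem_inter.1 (hp ▸ Finset.mem_singleton_self p)).2
    have hwp : wsum w (L ∩ L') = w p := by rw [hp]; simp [wsum]
    rcases h1 L hL p hpL with hp1 | hp2
    · rcases hcases with ⟨hk, hf⟩ | ⟨hk, hf⟩ | ⟨hk, hf⟩ | ⟨hk, hf⟩ | ⟨hk, hf⟩ | ⟨hk, hf⟩ <;>
        rcases hcases' with ⟨hk', hf'⟩ | ⟨hk', hf'⟩ | ⟨hk', hf'⟩ | ⟨hk', hf'⟩ | ⟨hk', hf'⟩ | ⟨hk', hf'⟩ <;>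
        first | omega | (rw [hk, hf, hk', hf']; decide)
    · have hfL : 1 ≤ fat w L := by
        unfold fat
        exact Finset.card_pos.2 ⟨p, Finset.mem_filter.2 ⟨hpL, hp2⟩⟩
      have hfL' : 1 ≤ fat w L' := by
        unfold fat
        exact Finset.card_pos.2 ⟨p, Finset.mem_filter.2 ⟨hpL', hp2⟩⟩
      rcases hcases with ⟨hk, hf⟩ | ⟨hk, hf⟩ | ⟨hk, hf⟩ | ⟨hk, hf⟩ | ⟨hk, hf⟩ | ⟨hk, hf⟩ <;>
        rcases hcases' with ⟨hk', hf'⟩ | ⟨hk', hf'⟩ | ⟨hk', hf'⟩ | ⟨hk', hf'⟩ | ⟨hk', hf'⟩ | ⟨hk', hf'⟩ <;>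
        first | omega | (rw [hk, hf, hk', hf']; decide)

include h1 h2 h3 h4 h7 in
/-- **A line of weight `4` leaves room for at most two others under the spread clause** (§13 (iii) allowed three): with three further
lines `a, b, c`, the line `c` lies in `b ∪ a ∪ L₁` with at most one point on each of them, hence has `≥ 2` points on `a ∪ L₁` and `≥ 1`
point off it; the sub-list `[c, a, L₁]` has `lineRank = lineRank [a, L₁] ≤ 4` and `wsum = wsum (a ∪ L₁) + (≥ 1)`, one more than the clause allows. -/
theorem card_le_three_of_weight_four_spread {L₁ : Finset β} (hL₁ : L₁ ∈ ls) (hw4 : wsum w L₁ = 4) : ls.card ≤ 3 := by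
  by_contra hlt
  push Not at hlt
  -- three further lines `a, b, c`
  have hcard : 2 < (ls.erase L₁).card := by
    rw [Finset.card_erase_of_mem hL₁]; omega
  obtain ⟨a, b, c, ha, hb, hc, hab, hac, hbc⟩ := Finset.two_lt_card_iff.1 hcard
  simp only [Finset.mem_erase] at ha hb hc
  have hw : ∀ L ∈ ls, ∀ v ∈ L, 1 ≤ w v := fun L hL v hv => by rcases h1 L hL v hv with h | h <;> omega
  -- shapes: `a` and `c` have three points and no fat point off `L₁`
  have hsa := shape_of_weight_four h1 h2 h3 h4 hL₁ ha.2 hb.2 ha.1 hb.1 hab.symm hw4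
  have hsc := shape_of_weight_four h1 h2 h3 h4 hL₁ hc.2 ha.2 hc.1 ha.1 hac hw4
  -- `c ⊆ b ∪ a ∪ L₁`
  have hcov := subset_of_weight_four h1 h2 h3 h4 hL₁ ha.2 hb.2 hc.2 ha.1 hb.1 hab.symm hc.1 hac.symm hbc.symm hw4
  -- the sub-list `[c, a, L₁]`
  have hsp := h7 [c, a, L₁] (by simp [ha.1, hc.1, hac.symm]) (by simp [hL₁, ha.2, hc.2])
  obtain ⟨a1, b1, c1, d1⟩ := cost_step w L₁ [] (hw L₁ hL₁)
  obtain ⟨a2, b2, c2, d2⟩ := cost_step w a [L₁] (hw a ha.2)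
  obtain ⟨a3, b3, c3, d3⟩ := cost_step w c [a, L₁] (hw c hc.2)
  obtain ⟨e0, e1, e2, e3⟩ := cost_start w L₁
  have i2 : (a ∩ unionL [L₁]).card ≤ 1 := by
    simp only [unionL, Finset.union_empty]
    exact h3 a ha.2 L₁ hL₁ ha.1
  have i3 : (c ∩ unionL [a, L₁]).card ≤ 2 := by
    simp only [unionL, Finset.union_empty]
    rw [Finset.inter_union_distrib_left]
    refine (Finset.card_union_le _ _).trans ?_
    have := h3 c hc.2 a ha.2 hac.symm
    have := h3 c hc.2 L₁ hL₁ hc.1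
    omega
  -- `c` has at most one point off `a ∪ L₁` (those lie on `b`)
  have i3' : (c \ unionL [a, L₁]).card ≤ 1 := by
    have hsub : c \ unionL [a, L₁] ⊆ c ∩ b := by
      intro v hv
      rw [Finset.mem_sdiff] at hv
      obtain ⟨hvc, hvU⟩ := hv
      rw [mem_unionL_iff] at hvU
      refine Finset.mem_inter.2 ⟨hvc, ?_⟩
      rcases hcov v hvc with h | h | h
      · exact h
      · exact absurd ⟨a, by simp, h⟩ hvU
      · exact absurd ⟨L₁, by simp, h⟩ hvU
    exact (Finset.card_le_card hsub).trans (h3 c hc.2 b hb.2 hbc.symm)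
  -- the weight of `a` off `L₁` is its number of points (no fat point off `L₁`)
  have f2 := wsum_sdiff_eq w a (unionL [L₁]) (h1 a ha.2)
  have hf : fat w (a \ unionL [L₁]) = fat w (a \ L₁) := by simp [unionL]
  have k1 := (h2 L₁ hL₁).1
  have ka := hsa.1
  have kc := hsc.1
  have hfa := hsa.2
  -- `lineRank [a, L₁] = 4 − |a ∩ L₁| ≤ 4`, `c` adds no rank, `wsum [c, a, L₁] ≥ 8 − |a ∩ L₁|`
  omega

end SpreadFour

end FourCap

end S1

end PercRepro
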